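import Summits.QuantumFields.BalabanUV.Beta.GAN24.CombChargeRowsOfBornContactLetters
import Summits.QuantumFields.BalabanUV.Beta.GAN24.CombBornLambdaContactBound
import Summits.QuantumFields.BalabanUV.Beta.GAN24.CombBornLambdaContactDrift
import Summits.QuantumFields.BalabanUV.Beta.GAN24.CombBornBorderContactBound
import Summits.QuantumFields.BalabanUV.Beta.GAN24.CombBornBorderContactPairBound

/-!
# `BalabanUV.Beta.GAN24.CombChargeRowsHold` — binder row G-an2-4 ∕ (CONV-C), TRANSFER-III, the (III′) (C)-row's END at row D1's literal of record:
# **THE (III′) END OF RECORD HOLDS — NO CONTACT LETTER LEFT.**  Gen 54's S54c `CombChargeRowsOfBornContactLetters` (END ⟸ the four born contact letters `hCg hPc hCv hPcV`,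
# `p q` implicit) with ALL FOUR DISCHARGED BY NAME at `p = q = 1` and an1's record `symTablesAn1S2 3 Lc cΛ`, `cE = Lc⁴`, `cVH = −Lc⁸∕2`, root `ctrOff 4 Lc` (record letters `hHff hVff hVmm hH hV` by
# `rfl` inside the proofs, exactly as gen 54's S54a `CombChargeRowsOfContactLetters`):
# `hCg :=` gan24-formalise-leaf-01 g90's (C11) `CombBornLambdaContactBound.exists_comb_hCg_ctr` · `hPc :=` their (PD) `CombBornLambdaContactDrift.exists_comb_hPc_ctr` ·
# `hCv :=` this gen's (18) `CombBornBorderContactBound.exists_comb_hCv_three` · `hPcV :=` this gen's (PB) `CombBornBorderContactPairBound.exists_comb_hPcV_three` — each from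
# `2 ≤ Lc` alone.  What remains displayed: `Odd Lc`, `2 ≤ Lc`, `2 ≤ N`, the pins `cΛ·Lc⁴ = 2`, `cB = −Lc¹²∕4` — the record's own parameters, no estimate.
# (G-an2-4 ∕ (CONV-C) OWNER `b2b-balaban-gan24-p1`, gen 55; journal [GAN24P1-G55-INTENT-8]; leaf-01 g90's M.104-level `(hS, hSall)` junction is the parallel statement one level down.)

NOT IN PRINT; OUR BOOKKEEPING ([folklore] one application BY NAME; 0 `def`, 0 cited fact, 0 `def … : Prop`, 0 sorry, NO analytic hypothesis).  HONEST FRAMING (cell contract,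
verbatim): «discharging `BetaPertH` makes Bałaban's UV stability UNCONDITIONAL — a real constructive-QFT result; it is NOT the continuum limit and NOT the Clay problem.»  HONEST
DEPENDENCY (verbatim): «continuum YM on T⁴ ⇐ BetaPertH ∧ nine spine estimates (0/9 proved); BetaPertH ⇐ (D1) ∧ (D4) ∧ CAP+tail; G-an2-4 gates asym, D1 and NE2/3/4.»  WHAT THIS IS
AND IS NOT: §1 is the all-scales geometric convergence (`AllScalesSeq`) of the second moments of `TbalOf Lc (JsB12CombShSym …)` — the (III′) comb chart OF RECORD at an1's sym tables —
and §2 row D1's drift reading at that literal as an `iff` with the limit VALUE (the value `lim β = stepBal Nc Lc` is row D1's and is NOT proved here).  It is the (CONV-C) row's END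
statement for THIS chart of record; it is NOT a statement about any other chart, NOT asym, NOT D1, NOT `BetaPertH`, NOT continuum, NOT Clay; «G-an2-4 closed» is the binder's call on
its own ledger line, not this file's.  2026-08-28; no existing file touched.
-/

noncomputable section

open Literature.MathematicalPhysics.QuantumFieldTheory
open Literature.MathematicalPhysics.QuantumFieldTheory.Balaban1983to89
open Literature.MathematicalPhysics.QuantumFieldTheory.Balaban1983to89.Beta
open scoped BigOperators
open RemainderConstAllScales (AllScalesSeq)
open OneStepKernelFamily (TbalOf D1Drift)
open AffineAveraging (Site box toSite)
open AveragingContoursRooted (ctr ctrOff ctrOff_mem_box)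
open Summit.QuantumFields.BalabanUV.Beta.SymmetrisedStepJets (SymTables)
open Summit.QuantumFields.BalabanUV.Beta.SymAveragingHessianCounts (symHessFFAt symVhSAt)
open Summit.QuantumFields.BalabanUV.Beta.CombChartJointEnd (JsB12CombShSym)
open Summit.QuantumFields.BalabanUV.Beta.SymSecondOrderTablesAn1 (symTablesAn1S2)
open Summit.QuantumFields.BalabanUV.Beta.GAN24.Push4 (IsFF)
open Summit.QuantumFields.BalabanUV.Beta.GAN24.CombChargeRowsOfBornContactLetters (exists_allScalesSeq_JsB12CombShSym_an1_of_bornContactLetters d1Drift_JsB12CombShSym_an1_iff_lim_eq_of_bornContactLetters)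
open Summit.QuantumFields.BalabanUV.Beta.GAN24.CombBornLambdaContactBound (exists_comb_hCg_ctr)
open Summit.QuantumFields.BalabanUV.Beta.GAN24.CombBornLambdaContactDrift (exists_comb_hPc_ctr)
open Summit.QuantumFields.BalabanUV.Beta.GAN24.CombBornBorderContactBound (exists_comb_hCv_three)
open Summit.QuantumFields.BalabanUV.Beta.GAN24.CombBornBorderContactPairBound (exists_comb_hPcV_three)

namespace Summit.QuantumFields.BalabanUV.Beta.GAN24.CombChargeRowsHold

variable {Lc : ℕ} [NeZero Lc]

set_option maxHeartbeats 1000000 in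
/-- NOT IN PRINT; OUR BOOKKEEPING.  §1 **THE (III′) END OF RECORD: ALL-SCALES GEOMETRIC CONVERGENCE OF THE SECOND MOMENTS OF THE COMB CHART OF RECORD** (`Odd Lc`, `2 ≤ Lc`, `2 ≤ N`,
`cΛ·Lc⁴ = 2`, `cB = −Lc¹²∕4`; NO contact letter): S54c §1 with `hCg := exists_comb_hCg_ctr`, `hPc := exists_comb_hPc_ctr` (leaf-01 g90), `hCv := exists_comb_hCv_three`,
`hPcV := exists_comb_hPcV_three` (this gen) at an1's record, `p = q = 1`. -/
theorem exists_allScalesSeq_JsB12CombShSym_an1 (hLc : Odd Lc) (hLc2 : 2 ≤ Lc) {N : ℕ} (hN : 2 ≤ N) {cΛ cB : ℝ} (hΛ : cΛ * (Lc : ℝ) ^ 4 = 2)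
    (hcB : cB = -((Lc : ℝ) ^ 12 / 4)) (μ ν : Fin 4) :
    ∃ κ θ : ℝ, 0 ≤ θ ∧ θ < 1 ∧ AllScalesSeq (fun j => B12Beta.secondMoment (TbalOf Lc (JsB12CombShSym hLc N (symTablesAn1S2 3 Lc cΛ) cΛ cB) j) μ ν) κ θ := by
  have hLc1 : 1 ≤ Lc := le_trans one_le_two hLc2
  have hHff : ∀ μ y, IsFF ((symTablesAn1S2 3 Lc cΛ).H μ y) :=
    fun μ y => ⟨fun x z μ' b => by cases b <;> rfl, fun x z a ν => by cases a <;> rfl⟩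
  have hVff : ∀ κ u x y (α β : Fin (3 + 1)), (symTablesAn1S2 3 Lc cΛ).V κ u x y (Sum.inl α) (Sum.inl β) = 0 :=
    fun _ _ _ _ _ _ => rfl
  have hVmm : ∀ κ u x y (μ ν : Fin (3 + 1)), (symTablesAn1S2 3 Lc cΛ).V κ u x y (Sum.inr μ) (Sum.inr ν) = 0 :=
    fun _ _ _ _ _ _ => rfl
  have hrr : ctrOff (3 + 1) Lc ∈ box (3 + 1) Lc := ctrOff_mem_box hLc1
  have hH : (symTablesAn1S2 3 Lc cΛ).H = symHessFFAt (toSite (ctrOff (3 + 1) Lc)) Lc := rfl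
  have hV : (symTablesAn1S2 3 Lc cΛ).V = symVhSAt (toSite (ctrOff (3 + 1) Lc)) 3 Lc rfl := rfl
  have hcE : ((Lc : ℝ) ^ 4 : ℝ) = (Lc : ℝ) ^ (3 + 1) := by norm_num
  have hcE' : |((Lc : ℝ) ^ 4 : ℝ)| ≤ (Lc : ℝ) ^ 4 := by rw [abs_of_nonneg (by positivity)]
  exact exists_allScalesSeq_JsB12CombShSym_an1_of_bornContactLetters hLc hLc2 hN hΛ hcB
    (exists_comb_hCg_ctr hLc2 (symTablesAn1S2 3 Lc cΛ) hHff hrr hH ((Lc : ℝ) ^ 4) cΛ hcE')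
    (exists_comb_hPc_ctr hLc2 (symTablesAn1S2 3 Lc cΛ) hHff hrr hH hcE' cΛ)
    (exists_comb_hCv_three (symTablesAn1S2 3 Lc cΛ) hVff hVmm hLc2 hrr hV ((Lc : ℝ) ^ 4) (-((Lc : ℝ) ^ 8 / 2)) hcE')
    (exists_comb_hPcV_three (symTablesAn1S2 3 Lc cΛ) hVff hVmm hLc2 hrr hV hcE (-((Lc : ℝ) ^ 8 / 2))) μ ν

set_option maxHeartbeats 1000000 in
/-- NOT IN PRINT; OUR BOOKKEEPING.  §2 **ROW D1's DRIFT READING AT ITS LITERAL OF RECORD, NO CONTACT LETTER** — S54c §2 with the four born letters discharged as in §1 (the VALUE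
`lim β = stepBal Nc Lc` is row D1's and is NOT proved). -/
theorem d1Drift_JsB12CombShSym_an1_iff_lim_eq (hLc : Odd Lc) (hLc2 : 2 ≤ Lc) {N : ℕ} (hN : 2 ≤ N) {cΛ cB : ℝ} (hΛ : cΛ * (Lc : ℝ) ^ 4 = 2)
    (hcB : cB = -((Lc : ℝ) ^ 12 / 4)) (μ ν : Fin 4) (Nc : ℝ) :
    D1Drift Lc (JsB12CombShSym hLc N (symTablesAn1S2 3 Lc cΛ) cΛ cB) Nc μ ν ↔
      RateCertificate.CauchyRate.lim (fun j => B12Beta.secondMoment (TbalOf Lc (JsB12CombShSym hLc N (symTablesAn1S2 3 Lc cΛ) cΛ cB) j) μ ν) =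
        B12Normalization.stepBal Nc Lc := by
  have hLc1 : 1 ≤ Lc := le_trans one_le_two hLc2
  have hHff : ∀ μ y, IsFF ((symTablesAn1S2 3 Lc cΛ).H μ y) :=
    fun μ y => ⟨fun x z μ' b => by cases b <;> rfl, fun x z a ν => by cases a <;> rfl⟩
  have hVff : ∀ κ u x y (α β : Fin (3 + 1)), (symTablesAn1S2 3 Lc cΛ).V κ u x y (Sum.inl α) (Sum.inl β) = 0 :=
    fun _ _ _ _ _ _ => rfl
  have hVmm : ∀ κ u x y (μ ν : Fin (3 + 1)), (symTablesAn1S2 3 Lc cΛ).V κ u x y (Sum.inr μ) (Sum.inr ν) = 0 :=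
    fun _ _ _ _ _ _ => rfl
  have hrr : ctrOff (3 + 1) Lc ∈ box (3 + 1) Lc := ctrOff_mem_box hLc1
  have hH : (symTablesAn1S2 3 Lc cΛ).H = symHessFFAt (toSite (ctrOff (3 + 1) Lc)) Lc := rfl
  have hV : (symTablesAn1S2 3 Lc cΛ).V = symVhSAt (toSite (ctrOff (3 + 1) Lc)) 3 Lc rfl := rfl
  have hcE : ((Lc : ℝ) ^ 4 : ℝ) = (Lc : ℝ) ^ (3 + 1) := by norm_num
  have hcE' : |((Lc : ℝ) ^ 4 : ℝ)| ≤ (Lc : ℝ) ^ 4 := by rw [abs_of_nonneg (by positivity)]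
  exact d1Drift_JsB12CombShSym_an1_iff_lim_eq_of_bornContactLetters hLc hLc2 hN hΛ hcB
    (exists_comb_hCg_ctr hLc2 (symTablesAn1S2 3 Lc cΛ) hHff hrr hH ((Lc : ℝ) ^ 4) cΛ hcE')
    (exists_comb_hPc_ctr hLc2 (symTablesAn1S2 3 Lc cΛ) hHff hrr hH hcE' cΛ)
    (exists_comb_hCv_three (symTablesAn1S2 3 Lc cΛ) hVff hVmm hLc2 hrr hV ((Lc : ℝ) ^ 4) (-((Lc : ℝ) ^ 8 / 2)) hcE')
    (exists_comb_hPcV_three (symTablesAn1S2 3 Lc cΛ) hVff hVmm hLc2 hrr hV hcE (-((Lc : ℝ) ^ 8 / 2))) μ ν Nc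

end Summit.QuantumFields.BalabanUV.Beta.GAN24.CombChargeRowsHold

end
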